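import Literature.AlgebraicGeometry.HodgeTheory.HodgeGenericPointsComeagre
import Literature.AlgebraicGeometry.HodgeTheory.HodgeGenericPointsOffSmallCover
import HarnessLib

/-!
# The non-Hodge-generic points of a smooth projective family lie in a countable union of small sets
# (Deligne 1972 Prop. 7.5 / André 1992 Lemma 4, keeping track of the exceptional loci)

Family `hodge`, layer `Literature/AlgebraicGeometry/HodgeTheory`. Theorems only (no definition, no named
fact). Written by the prover seat `hodge-nonav-prover-Ax` (g13, cell `hodge-nonav`), programme «AE»
(route `HodgeConjecture/CyclicUnitaryPowers`, `--supports stmt-HodgeConjecture-19544`).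

`HodgeGenericPointsComeagre.isMeagre_setOf_not_isHodgeGenericPoint_of_hodgeLociDichotomy` (same seat,
g11) concludes from the local dichotomy of Hodge loci that the non-Hodge-generic points
(`¬ IsHodgeGenericPoint`) of a smooth projective family over a smooth quasi-projective base form a MEAGRE
set. This file is its refinement through `exists_countable_small_cover_of_lociAlternative`:

* `exists_countable_cover_not_isHodgeGenericPoint_of_lociAlternative` — for ANY predicate `Small` on
  subsets of `S(ℂ)`: if the Hodge loci satisfy the local alternative «all of the chart, or inside a
  `Small` closed nowhere-dense set» at every base point, then the non-Hodge-generic points lie in `⋃₀ 𝒞`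
  for a COUNTABLE family `𝒞` of `Small` nowhere-dense sets (countable dense set of base points; open path
  components; `isHodgeGenericPoint_of_generic`).

Consumers: `HodgeLociAnalyticCoverOfWeightTwoFrames` (surfaces, `Small` = local analytic hypersurfaces in
prescribed charts), and through it the Lebesgue-null ∕ meagre exceptional set of the Carlson–Toledo family
of cyclic covers. Honest scope: bookkeeping; nothing here says HC or any rung is proved.

## References

* [Deligne1972WeilK3] P. Deligne, La conjecture de Weil pour les surfaces K3, Invent. Math. 15 (1972),
  Prop. 7.5.
* [Andre1992] Y. André, Mumford–Tate groups of mixed Hodge structures …, Compositio Math. 82 (1992), §4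
  Lemma 4.
* [CarlsonMullerStachPeters2017] J. Carlson, S. Müller-Stach, C. Peters, Period Mappings and Period
  Domains, 2nd ed., Def. 15.3.5.
-/

noncomputable section

open CategoryTheory AlgebraicGeometry
open _root_.Topology _root_.Filter
open scoped TensorProduct
open Literature.AlgebraicTopology.SingularHomology
open Literature.AlgebraicGeometry.Motives

namespace Literature.AlgebraicGeometry.HodgeTheory

section HodgeTheory

section Cover

/-- **The non-Hodge-generic points lie in a countable union of small sets** (Deligne 1972 Prop. 7.5,
zero-set form; bookkeeping). For a smooth projective family `f : 𝒳 ⟶ S` of relative dimension `n` over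
a smooth quasi-projective base of dimension `d`, Hodge-symmetric models `A t`, degree `k`, and ANY
predicate `Small` on subsets of `S(ℂ)`: if for every base point `s` every point `t₁` has arbitrarily
small path-connected open neighbourhoods `W` on which, for every rational tensor `ζ`, every `x ∈ W` and
every admissible state `Tx` at `x`, the locus where `ζ` is a weight-`0` Hodge tensor along the
continuations of `Tx` inside `W` is all of `W` or contained in a `Small`, nowhere-dense set closed in
`W`, then there is a COUNTABLE family `𝒞` of `Small` nowhere-dense sets with
`{t | ¬ IsHodgeGenericPoint} ⊆ ⋃₀ 𝒞`. Proof: `S(ℂ)` is a second countable manifold with open path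
components; `exists_countable_small_cover_of_lociAlternative` at each point of a countable dense set of
base points; `isHodgeGenericPoint_of_generic`. [cite: Deligne1972WeilK3, Prop. 7.5]
[cite: Andre1992, §4 Lemma 4] [cite: CarlsonMullerStachPeters2017, Definition 15.3.5] -/
theorem exists_countable_cover_not_isHodgeGenericPoint_of_lociAlternative
    [HodgeTensorFacts.{0, 0}] {𝒳 S : SchemeOver ℂ} (f : 𝒳 ⟶ S) (n k d : ℕ)
    (hf : IsSmoothProjectiveFamily f n) (hS : IsQuasiProjectiveOver S)
    [AlgebraicGeometry.SmoothOfRelativeDimension d S.hom]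
    (hU : IsCohomologicallyLocallyTrivialOn f (Set.univ : Set (ComplexPoints S)))
    (A : ∀ t : ComplexPoints S, HodgeModel n (fiberOver f t)) (hA : ∀ t, (A t).IsHodgeSymmetric)
    [∀ t, Module.Finite ℚ (singularCohomology ℚ ℚ (ComplexPoints (fiberOver f t)) k)]
    (Small : Set (Set.univ : Set (ComplexPoints S)) → Prop)
    (hD : ∀ (s t₁ : (Set.univ : Set (ComplexPoints S))), ∀ N ∈ 𝓝 t₁,
      ∃ W : Set (Set.univ : Set (ComplexPoints S)), IsOpen W ∧ t₁ ∈ W ∧ W ⊆ N ∧ IsPathConnected W ∧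
      ∀ (a b : ℕ) (ζ : hodgeTensorSpace (singularCohomology ℚ ℚ (ComplexPoints (fiberOver f (Subtype.val s))) k) a b) (x : (Set.univ : Set (ComplexPoints S))),
        x ∈ W → ∀ (Tx : singularCohomology ℚ ℚ (ComplexPoints (fiberOver f (Subtype.val s))) k ≃ₗ[ℚ]
          singularCohomology ℚ ℚ (ComplexPoints (fiberOver f (Subtype.val x))) k),
        (∃ δ : Path.Homotopic.Quotient s x,
          ∀ v, ofRatClass _ k (Tx v) = transportFun f k hU δ (ofRatClass _ k v)) →
        (∀ t ∈ W, ∀ (ε : Path x t), (∀ r, ε r ∈ W) → ∀ (T : singularCohomology ℚ ℚ (ComplexPoints (fiberOver f (Subtype.val s))) k ≃ₗ[ℚ]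
          singularCohomology ℚ ℚ (ComplexPoints (fiberOver f (Subtype.val t))) k),
          (∀ v, ofRatClass _ k (T v) = transportFun f k hU ⟦ε⟧ (ofRatClass _ k (Tx v))) →
          ζ ∈ ((((A t.1).hodgeStructure (hf.isSmoothProjective t.1) (hA t.1) k).comapEquiv T).tensorSpace
            a b).hodgeClasses 0) ∨
        ∃ Z : Set (Set.univ : Set (ComplexPoints S)), Small Z ∧ IsNowhereDense Z ∧ (∀ t ∈ W, t ∈ closure Z → t ∈ Z) ∧
        {t : (Set.univ : Set (ComplexPoints S)) | t ∈ W ∧ ∀ (ε : Path x t),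
          (∀ r, ε r ∈ W) → ∀ (T : singularCohomology ℚ ℚ (ComplexPoints (fiberOver f (Subtype.val s))) k ≃ₗ[ℚ]
            singularCohomology ℚ ℚ (ComplexPoints (fiberOver f (Subtype.val t))) k),
          (∀ v, ofRatClass _ k (T v) = transportFun f k hU ⟦ε⟧ (ofRatClass _ k (Tx v))) →
          ζ ∈ ((((A t.1).hodgeStructure (hf.isSmoothProjective t.1) (hA t.1) k).comapEquiv T).tensorSpace
            a b).hodgeClasses 0} ⊆ Z) :
    ∃ 𝒞 : Set (Set (Set.univ : Set (ComplexPoints S))), 𝒞.Countable ∧ (∀ Z ∈ 𝒞, Small Z ∧ IsNowhereDense Z) ∧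
      {t : (Set.univ : Set (ComplexPoints S)) | ¬ IsHodgeGenericPoint f k hU hf A hA t} ⊆ ⋃₀ 𝒞 := by
  classical
  -- topology of `S(ℂ)`: a second countable topological manifold
  haveI : AlgebraicGeometry.LocallyOfFiniteType S.hom := hS.locallyOfFiniteType
  haveI : AlgebraicGeometry.IsSeparated S.hom := hS.isVarietyPair_ofScheme.isSeparated
  haveI : AlgebraicGeometry.QuasiCompact S.hom := hS.isVarietyPair_ofScheme.quasiCompact
  haveI : CompactSpace S.left := QuasiCompact.compactSpace_of_compactSpace S.hom
  haveI : T2Space (ComplexPoints S) := Literature.NumberTheory.Transcendental.t2Space_algPoints_holds _ ℂ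
  letI := Motives.ComplexPoints.chartedSpace S d
  haveI : LocallyPathConnectedSpace (ComplexPoints S) :=
    ChartedSpace.locallyPathConnectedSpace (EuclideanSpace ℝ (Fin (2 * d))) _
  haveI : SecondCountableTopology (ComplexPoints S) :=
    Motives.ComplexPoints.secondCountableTopology_of_compactSpace_holds _
  haveI : LocallyPathConnectedSpace (Set.univ : Set (ComplexPoints S)) :=
    isOpen_univ.locallyPathConnectedSpace
  haveI : ∀ (x : (Set.univ : Set (ComplexPoints S))) (a b : ℕ), Countable (hodgeTensorSpace
      (singularCohomology ℚ ℚ (ComplexPoints (fiberOver f x.1)) k) a b) :=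
    fun x a b ↦ by
      haveI : Module.Finite ℚ (hodgeTensorSpace
          (singularCohomology ℚ ℚ (ComplexPoints (fiberOver f x.1)) k) a b) :=
        Module.Finite.of_basis (hodgeTensorBasis (Module.finBasis ℚ _) a b)
      exact countable_of_module_finite_rat _
  have hrat : ∀ (x y : (Set.univ : Set (ComplexPoints S))) (γ : Path.Homotopic.Quotient x y)
      (α : complexBetti (fiberOver f x.1) k), IsRationalClass α →
      IsRationalClass (transportFun f k hU γ α) :=
    fun x y γ α hα ↦ isRationalClass_transportFun_of_isSmoothProjectiveFamily f k d hf hS γ hα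
  -- the countable small cover attached to a base point `x`
  have hM : ∀ x : (Set.univ : Set (ComplexPoints S)), ∃ 𝒞 : Set (Set (Set.univ : Set (ComplexPoints S))),
      𝒞.Countable ∧ (∀ Z ∈ 𝒞, Small Z ∧ IsNowhereDense Z) ∧ ∀ t₀ ∉ ⋃₀ 𝒞,
        ∀ (δ₀ : Path.Homotopic.Quotient x t₀)
        (T₀ : singularCohomology ℚ ℚ (ComplexPoints (fiberOver f (Subtype.val x))) k ≃ₗ[ℚ]
          singularCohomology ℚ ℚ (ComplexPoints (fiberOver f (Subtype.val t₀))) k),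
        (∀ v, ofRatClass _ k (T₀ v) = transportFun f k hU δ₀ (ofRatClass _ k v)) →
        ∀ q : (Σ a b : ℕ, hodgeTensorSpace (singularCohomology ℚ ℚ (ComplexPoints (fiberOver f x.1)) k) a b),
          q.2.2 ∈ ((((A t₀.1).hodgeStructure (hf.isSmoothProjective t₀.1) (hA t₀.1) k).comapEquiv
            T₀).tensorSpace q.1 q.2.1).hodgeClasses 0 →
          ∀ (t : (Set.univ : Set (ComplexPoints S))) (δ : Path.Homotopic.Quotient x t)
            (T : singularCohomology ℚ ℚ (ComplexPoints (fiberOver f (Subtype.val x))) k ≃ₗ[ℚ]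
              singularCohomology ℚ ℚ (ComplexPoints (fiberOver f (Subtype.val t))) k),
            (∀ v, ofRatClass _ k (T v) = transportFun f k hU δ (ofRatClass _ k v)) →
            q.2.2 ∈ ((((A t.1).hodgeStructure (hf.isSmoothProjective t.1) (hA t.1) k).comapEquiv
              T).tensorSpace q.1 q.2.1).hodgeClasses 0 := by
    intro x
    exact exists_countable_small_cover_of_lociAlternative f k hU x hrat
      (ι := Σ a b : ℕ, hodgeTensorSpace (singularCohomology ℚ ℚ (ComplexPoints (fiberOver f x.1)) k) a b)
      (fun q t T ↦ q.2.2 ∈ ((((A t.1).hodgeStructure (hf.isSmoothProjective t.1) (hA t.1) k).comapEquiv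
        T).tensorSpace q.1 q.2.1).hodgeClasses 0) Small
      (fun t₁ N hN ↦ by
        obtain ⟨W, hWo, ht₁W, hWN, hWpc, hW⟩ := hD x t₁ N hN
        exact ⟨W, hWo, ht₁W, hWN, hWpc, fun q y hy Ty hTy ↦ hW q.1 q.2.1 q.2.2 y hy Ty hTy⟩)
  choose M hMc hMs hMg using hM
  -- a countable dense set of base points
  obtain ⟨D, hDc, hDd⟩ := TopologicalSpace.exists_countable_dense (Set.univ : Set (ComplexPoints S))
  refine ⟨⋃ x ∈ D, M x, hDc.biUnion fun x _ ↦ hMc x, fun Z hZ ↦ ?_, ?_⟩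
  · obtain ⟨x, hx⟩ := Set.mem_iUnion.1 hZ
    obtain ⟨-, hZx⟩ := Set.mem_iUnion.1 hx
    exact hMs x Z hZx
  intro t₀ ht₀
  rw [Set.mem_setOf_eq] at ht₀
  by_contra hnot
  apply ht₀
  -- a base point of `D` in the (open) path component of `t₀`
  obtain ⟨x, hxD, hxP⟩ := hDd.exists_mem_open (IsOpen.pathComponent t₀) ⟨t₀, mem_pathComponent_self t₀⟩
  have hj : Joined x t₀ := Joined.symm hxP
  obtain ⟨T₀, hT₀⟩ := exists_ratTransport f k hU hrat (⟦hj.somePath⟧ : Path.Homotopic.Quotient x t₀)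
  have ht₀M : t₀ ∉ ⋃₀ M x := fun h ↦ by
    obtain ⟨Z, hZ, htZ⟩ := Set.mem_sUnion.1 h
    exact hnot (Set.mem_sUnion.2 ⟨Z, Set.mem_biUnion hxD hZ, htZ⟩)
  exact isHodgeGenericPoint_of_generic f k hU hf A hA hT₀ fun a b ζ hζ t δ T hT ↦
    hMg x t₀ ht₀M _ T₀ hT₀ ⟨a, b, ζ⟩ hζ t δ T hT

end Cover

end HodgeTheory

end Literature.AlgebraicGeometry.HodgeTheory

end
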